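import Mathlib
import Summits.Ventures.PercRepro2.Defs
import Summits.Ventures.PercRepro2.Independence
import Summits.Ventures.PercRepro2.Harris
import Summits.Ventures.PercRepro2.Graph
import Summits.Ventures.PercRepro2.Events
import Summits.Ventures.PercRepro2.PartitionThree
import Summits.Ventures.PercRepro2.ZCLeafReductionsGraph

/-!
# (ZC) reduces to the cluster-blind events `{C(a₁) ∪ C'(a₃) ∪ C'(o) ∈ 𝓔}` (blind cell PercRepro2, mine-a g28)

Let `C'(v)` be the cluster of `v` in `G − a₁` (every edge at `a₁` closed).  For an up-set `𝓔` of vertex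
sets the **cluster-blind event** is `Ũ := {C(a₁) ∪ C'(a₃) ∪ C'(o) ∈ 𝓔}` — the clusters of the two
marks in `G − a₁` are attached to the root cluster whether or not `a₁` reaches them.  It is an
increasing event containing `U = {C(a₁) ∈ 𝓔}`, it agrees with `U` on `e ∩ L` (there `C(a₁)` already
contains `C'(a₃)` and `C'(o)`), and the (ZC) expression of `𝓔` dominates the (ZC) expression of `Ũ`:
`Z(𝓔) − Z(Ũ) = (P(Ũ) − P(U)) · (P(D)P(eL) − P(B)P(e¬L)) + P(B) · P((Ũ ∖ U) ∩ e¬L) ≥ 0`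
by lemma (P1) (`partitionThree_lattice`).  Hence **(ZC) for every cluster up-set follows from (ZC) for
the cluster-blind events** (`zc_of_cluster_blind`).  The point of the reduction: given the configuration
of `G − a₁`, the event `Ũ` is independent of `e` and `L` (it only looks at the edges of `a₁` into the
blocks other than `C'(a₃)`, `C'(o)`), so its (ZC) expression is a pure "between" covariance of the
partition of `G − a₁` — the conjecture `(Θ-PA)` of MINE-A.md §78.
-/

namespace Summit.Ventures.PercRepro2

variable {V : Type*} {E : Type*} [Fintype V] [DecidableEq V] [Fintype E] [DecidableEq E]
  {R : Type*} [CommRing R] [LinearOrder R] [IsStrictOrderedRing R]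

/-- The configuration with every edge at the vertex `a₁` closed (the graph `G − a₁`). -/
def deleteVertex (ends : E → Sym2 V) (a₁ : V) (ω : Config E) : Config E :=
  restrict (touches ends (↑({a₁} : Finset V) : Set V))ᶜ ω

omit [Fintype E] [DecidableEq E] in
/-- `G − a₁` has fewer open edges. -/
lemma deleteVertex_le (ends : E → Sym2 V) (a₁ : V) (ω : Config E) :
    deleteVertex ends a₁ ω ≤ ω :=
  restrict_le _ ω

omit [Fintype E] [DecidableEq E] in
/-- Deleting a vertex is monotone in the configuration. -/
lemma deleteVertex_mono (ends : E → Sym2 V) (a₁ : V) {ω ω' : Config E} (h : ω ≤ ω') :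
    deleteVertex ends a₁ ω ≤ deleteVertex ends a₁ ω' := by
  intro e
  simp only [deleteVertex, restrict]
  by_cases he : e ∈ (touches ends (↑({a₁} : Finset V) : Set V))ᶜ
  · simp only [he, decide_true, Bool.and_true]
    exact h e
  · simp only [he, decide_false, Bool.and_false, le_refl]

/-- The cluster-blind event `{C(a₁) ∪ C'(a₃) ∪ C'(o) ∈ 𝓔}`, `C'` the clusters in `G − a₁`. -/
def clusterBlindEvent (ends : E → Sym2 V) (a₁ a₃ o : V) (𝓔 : Set (Set V)) : Set (Config E) :=
  {ω | cluster ends ω a₁ ∪ cluster ends (deleteVertex ends a₁ ω) a₃ ∪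
    cluster ends (deleteVertex ends a₁ ω) o ∈ 𝓔}

omit [Fintype E] [DecidableEq E] in
/-- Membership in the cluster-blind event. -/
@[simp] lemma mem_clusterBlindEvent {ends : E → Sym2 V} {a₁ a₃ o : V} {𝓔 : Set (Set V)}
    {ω : Config E} :
    ω ∈ clusterBlindEvent ends a₁ a₃ o 𝓔 ↔
      cluster ends ω a₁ ∪ cluster ends (deleteVertex ends a₁ ω) a₃ ∪
        cluster ends (deleteVertex ends a₁ ω) o ∈ 𝓔 := Iff.rfl

omit [Fintype E] [DecidableEq E] in
/-- The cluster-blind event of an up-set is increasing. -/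
lemma isUpperSet_clusterBlindEvent (ends : E → Sym2 V) (a₁ a₃ o : V) {𝓔 : Set (Set V)}
    (h𝓔 : IsUpperSet 𝓔) : IsUpperSet (clusterBlindEvent ends a₁ a₃ o 𝓔) := by
  intro ω ω' h hω
  simp only [mem_clusterBlindEvent] at hω ⊢
  refine h𝓔 ?_ hω
  have hd := deleteVertex_mono ends a₁ h
  exact Set.union_subset_union (Set.union_subset_union (cluster_mono h a₁) (cluster_mono hd a₃))
    (cluster_mono hd o)

omit [Fintype E] [DecidableEq E] in
/-- `U ⊆ Ũ`. -/
lemma clusterInEvent_subset_clusterBlindEvent (ends : E → Sym2 V) (a₁ a₃ o : V)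
    {𝓔 : Set (Set V)} (h𝓔 : IsUpperSet 𝓔) :
    clusterInEvent ends a₁ 𝓔 ⊆ clusterBlindEvent ends a₁ a₃ o 𝓔 := by
  intro ω hω
  simp only [mem_clusterInEvent] at hω
  simp only [mem_clusterBlindEvent]
  exact h𝓔 (Set.subset_union_left.trans Set.subset_union_left) hω

omit [Fintype E] [DecidableEq E] in
/-- If `a₁ ↔ v`, the cluster of `v` in `G − a₁` lies inside the cluster of `a₁`. -/
lemma cluster_deleteVertex_subset_of_conn {ends : E → Sym2 V} {ω : Config E} {a₁ v : V}
    (h : Conn ends ω a₁ v) :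
    cluster ends (deleteVertex ends a₁ ω) v ⊆ cluster ends ω a₁ := by
  intro u hu
  have hu' : u ∈ cluster ends ω v := cluster_mono (deleteVertex_le ends a₁ ω) v hu
  rw [cluster_eq_of_conn h]
  exact hu'

omit [Fintype E] [DecidableEq E] in
/-- On `e ∩ L` the cluster-blind event is the cluster event. -/
lemma clusterBlindEvent_inter_eL (ends : E → Sym2 V) (a₁ a₃ o : V) (𝓔 : Set (Set V)) :
    clusterBlindEvent ends a₁ a₃ o 𝓔 ∩ (connEvent ends a₁ a₃ ∩ connEvent ends a₁ o) =
      clusterInEvent ends a₁ 𝓔 ∩ (connEvent ends a₁ a₃ ∩ connEvent ends a₁ o) := by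
  ext ω
  simp only [Set.mem_inter_iff, mem_clusterBlindEvent, mem_clusterInEvent, mem_connEvent]
  constructor
  · rintro ⟨hU, h13, h1o⟩
    refine ⟨?_, h13, h1o⟩
    rwa [Set.union_eq_left.2 (cluster_deleteVertex_subset_of_conn h13),
      Set.union_eq_left.2 (cluster_deleteVertex_subset_of_conn h1o)] at hU
  · rintro ⟨hU, h13, h1o⟩
    refine ⟨?_, h13, h1o⟩
    rwa [Set.union_eq_left.2 (cluster_deleteVertex_subset_of_conn h13),
      Set.union_eq_left.2 (cluster_deleteVertex_subset_of_conn h1o)]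

/-- **The cluster-blind reduction**: the (ZC) expression of a cluster up-set dominates the (ZC)
expression of its cluster-blind event `{C(a₁) ∪ C'(a₃) ∪ C'(o) ∈ 𝓔}`. -/
theorem zc_cluster_blind_le {ends : E → Sym2 V} {p : E → R} (hp : IsProbVec p) (a₁ a₃ o : V)
    {𝓔 : Set (Set V)} (h𝓔 : IsUpperSet 𝓔) :
    let e := connEvent ends a₁ a₃
    let L' := connEvent ends a₁ o
    let γ := connEvent ends a₃ o
    let U := clusterInEvent ends a₁ 𝓔
    let U' := clusterBlindEvent ends a₁ a₃ o 𝓔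
    prob p (eᶜ ∩ L'ᶜ ∩ γᶜ) * (prob p (U' ∩ (e ∩ L')) - prob p U' * prob p (e ∩ L'))
      - prob p (eᶜ ∩ L'ᶜ ∩ γ) * (prob p (U' ∩ (e ∩ L'ᶜ)) - prob p U' * prob p (e ∩ L'ᶜ)) ≤
    prob p (eᶜ ∩ L'ᶜ ∩ γᶜ) * (prob p (U ∩ (e ∩ L')) - prob p U * prob p (e ∩ L'))
      - prob p (eᶜ ∩ L'ᶜ ∩ γ) * (prob p (U ∩ (e ∩ L'ᶜ)) - prob p U * prob p (e ∩ L'ᶜ)) := by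
  intro e L' γ U U'
  have hsub : U ⊆ U' := clusterInEvent_subset_clusterBlindEvent ends a₁ a₃ o h𝓔
  have hUeL : U' ∩ (e ∩ L') = U ∩ (e ∩ L') := clusterBlindEvent_inter_eL ends a₁ a₃ o 𝓔
  -- lemma (P1) for the marks `(a₁, a₃, o)`: `P(B) · P(e¬L) ≤ P(eL) · P(D)`
  have hP1 : prob p (e ∩ L'ᶜ) * prob p (eᶜ ∩ L'ᶜ ∩ γ) ≤
      prob p (e ∩ L') * prob p (eᶜ ∩ L'ᶜ ∩ γᶜ) := by
    have h := partitionThree_lattice hp ends a₁ a₃ o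
    rw [partBCa_eq_three, partAll_eq_ab_ac] at h
    simpa only [partABc, partApart, e, L', γ] using h
  have hΔ : prob p U ≤ prob p U' := prob_mono hp hsub
  have hΔ' : prob p (U ∩ (e ∩ L'ᶜ)) ≤ prob p (U' ∩ (e ∩ L'ᶜ)) :=
    prob_mono hp (Set.inter_subset_inter_left _ hsub)
  have hB := prob_nonneg hp (eᶜ ∩ L'ᶜ ∩ γ)
  rw [hUeL]
  nlinarith [mul_nonneg (sub_nonneg.2 hΔ) (sub_nonneg.2 hP1), mul_nonneg hB (sub_nonneg.2 hΔ')]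

/-- **(ZC) for every cluster up-set follows from (ZC) for the cluster-blind events**: if the (ZC)
expression of `{C(a₁) ∪ C'(a₃) ∪ C'(o) ∈ 𝓔}` is nonnegative for every up-set `𝓔`, then the (ZC)
expression of `{C(a₁) ∈ 𝓔}` is nonnegative for every up-set `𝓔`. -/
theorem zc_of_cluster_blind {ends : E → Sym2 V} {p : E → R} (hp : IsProbVec p) (a₁ a₃ o : V)
    (hblind : ∀ 𝓔' : Set (Set V), IsUpperSet 𝓔' →
      let e := connEvent ends a₁ a₃
      let L' := connEvent ends a₁ o
      let γ := connEvent ends a₃ o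
      let U' := clusterBlindEvent ends a₁ a₃ o 𝓔'
      0 ≤ prob p (eᶜ ∩ L'ᶜ ∩ γᶜ) * (prob p (U' ∩ (e ∩ L')) - prob p U' * prob p (e ∩ L'))
        - prob p (eᶜ ∩ L'ᶜ ∩ γ) * (prob p (U' ∩ (e ∩ L'ᶜ)) - prob p U' * prob p (e ∩ L'ᶜ)))
    {𝓔 : Set (Set V)} (h𝓔 : IsUpperSet 𝓔) :
    let e := connEvent ends a₁ a₃
    let L' := connEvent ends a₁ o
    let γ := connEvent ends a₃ o
    let U := clusterInEvent ends a₁ 𝓔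
    0 ≤ prob p (eᶜ ∩ L'ᶜ ∩ γᶜ) * (prob p (U ∩ (e ∩ L')) - prob p U * prob p (e ∩ L'))
      - prob p (eᶜ ∩ L'ᶜ ∩ γ) * (prob p (U ∩ (e ∩ L'ᶜ)) - prob p U * prob p (e ∩ L'ᶜ)) := by
  intro e L' γ U
  have h1 := zc_cluster_blind_le (ends := ends) hp a₁ a₃ o h𝓔
  have h2 := hblind 𝓔 h𝓔
  simp only at h1 h2
  exact le_trans h2 h1

end Summit.Ventures.PercRepro2
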